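import Summits.AnomalousDissipation.AnomalousDissipation.Theorems.KolmogorovFloor.Negative.CheapBaseTools
import Summits.AnomalousDissipation.AnomalousDissipation.Theorems.KolmogorovFloor.Negative.FarField
import Literature.Analysis.FunctionSpaces.TorusFourierSeries

/-!
# CHEAP states from a far-field shear dressed with a linear response — the bookkeeping
(negative side of `TaylorCertificates.KolmogorovFloor`, crux stmt-AnomalousDissipation-15122)

cdisprove seat `refuter-cdisprove-stmt-AnomalousDissipation-15122-0` (2026-08-16). File `ResponseCheapFarField` of the CHEAP bookkeeping:
the NUMERIC form. Given an exact Euler shear `U` (`(U·∇)U = 0`) and a field `b` with energy / enstrophy / slope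
budgets, a LINEARISED steady-Euler defect `(U·∇)b + (b·∇)U − P_L f` of size `δlin·M` and a self-advection of size
`δsa·M` against band-limited solenoidal multipliers of slope `≤ M`, and a tail bound `Σ_{κ ∉ ball L} ‖f̂(κ)‖ ≤ T`
on finite sets, the dressed state `a = s•U + t•b` (`s t = 1`) satisfies the five CHEAP budgets of the landed
interface `CheapSteadyEulerStates` at the parameter `η` as soon as five numeric inequalities hold
(`cheapAt_of_farField`). The defect splits by `farField_defect` into the linearised defect, `t²` times the
self-advection, and the truncation tail `(P_L f − f, W)`, which is read on the Fourier side
(`Torus.integral_inner_eq_sum_freqBall`, `mFourierCoeff_fourierTruncate_sub`) and costs `T·M` because a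
band-limited multiplier of slope `≤ M` has `‖Ŵ(κ)‖ ≤ M` off the origin. The work is bounded WITHOUT Parseval:
`|(b, f)| ≤ (∫‖b‖² + ∫‖f‖²)/2` (Young).
-/

noncomputable section

set_option linter.dupNamespace false

open MeasureTheory UnitAddTorus Matrix
open scoped InnerProductSpace ENNReal ComplexConjugate

namespace Summit.AnomalousDissipation.AnomalousDissipation.Theorems.KolmogorovFloor.Negative

open Literature.Analysis.FunctionSpaces Literature.Analysis.FluidPDE
open Summit.AnomalousDissipation.AnomalousDissipation.Theorems.TaylorCertificatePair.Negative

local notation "𝕋" => UnitAddTorus (Fin 3)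
local notation "E³" => EuclideanSpace ℝ (Fin 3)

/-! ### Three small tools -/

/-- Young's inequality for the `L²` pairing of two smooth fields: `|(b, f)| ≤ (∫‖b‖² + ∫‖f‖²)/2`. -/
theorem abs_integral_inner_le_half_add {b f : 𝕋 → E³} (hb : Torus.IsSmooth b) (hf : Torus.IsSmooth f) :
    |∫ x, ⟪b x, f x⟫_ℝ| ≤ ((∫ x, ‖b x‖ ^ 2) + ∫ x, ‖f x‖ ^ 2) / 2 := by
  have h1 : Integrable (fun x => ‖b x‖ ^ 2) volume := (hb.norm_sq).integrable
  have h2 : Integrable (fun x => ‖f x‖ ^ 2) volume := (hf.norm_sq).integrable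
  calc |∫ x, ⟪b x, f x⟫_ℝ| ≤ ∫ x, |⟪b x, f x⟫_ℝ| := abs_integral_le_integral_abs
    _ ≤ ∫ x, ((‖b x‖ ^ 2 + ‖f x‖ ^ 2) / 2) := by
        refine integral_mono_of_nonneg (ae_of_all _ fun x => abs_nonneg _) ((h1.add h2).div_const 2)
          (ae_of_all _ fun x => ?_)
        have h := abs_real_inner_le_norm (b x) (f x)
        nlinarith [h, sq_nonneg (‖b x‖ - ‖f x‖), norm_nonneg (b x), norm_nonneg (f x)]
    _ = ((∫ x, ‖b x‖ ^ 2) + ∫ x, ‖f x‖ ^ 2) / 2 := by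
        rw [integral_div, integral_add h1 h2]

/-- Work of the dressed state, in general: `(s•U + t•b, f) = s (U, f) + t (b, f)`. -/
theorem work_farField_eq {U b f : 𝕋 → E³} (hU : Torus.IsSmooth U) (hb : Torus.IsSmooth b) (hf : Torus.IsSmooth f)
    (s t : ℝ) :
    ∫ x, ⟪(s • U + t • b) x, f x⟫_ℝ = s * (∫ x, ⟪U x, f x⟫_ℝ) + t * ∫ x, ⟪b x, f x⟫_ℝ := by
  have h1 : Integrable (fun x => ⟪U x, f x⟫_ℝ) volume := (hU.inner hf).integrable
  have h2 : Integrable (fun x => ⟪b x, f x⟫_ℝ) volume := (hb.inner hf).integrable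
  have e : (fun x => ⟪(s • U + t • b) x, f x⟫_ℝ) = fun x => s * ⟪U x, f x⟫_ℝ + t * ⟪b x, f x⟫_ℝ := by
    funext x
    simp only [Pi.add_apply, Pi.smul_apply, inner_add_left, inner_smul_left, conj_trivial]
  rw [e, integral_add (h1.const_mul s) (h2.const_mul t), integral_const_mul, integral_const_mul]

/-- **The truncation tail against a band-limited multiplier.** If `Σ_{κ ∈ S} ‖f̂(κ)‖ ≤ T` for every finite set `S`
of lattice points outside the ball of radius `L`, then for every smooth `W` band-limited at `N` with
`|κ|‖Ŵ(κ)‖ ≤ M`: `|(P_L f − f, W)| ≤ T·M`. -/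
theorem abs_integral_inner_truncate_sub_le {f W : 𝕋 → E³} (hf : Torus.IsSmooth f) (hW : Torus.IsSmooth W)
    {L N : ℕ} {M T : ℝ}
    (hband : ∀ κ, (N : ℝ) ^ 2 < Torus.freqNormSq κ → mFourierCoeff (EuclideanSpace.complexify ∘ W) κ = 0)
    (hM : ∀ κ, Real.sqrt (Torus.freqNormSq κ) * ‖mFourierCoeff (EuclideanSpace.complexify ∘ W) κ‖ ≤ M)
    (hT : ∀ S : Finset (Fin 3 → ℤ), (∀ κ ∈ S, κ ∉ Torus.freqBall L) →
      ∑ κ ∈ S, ‖mFourierCoeff (EuclideanSpace.complexify ∘ f) κ‖ ≤ T) :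
    |∫ x, ⟪(Torus.fourierTruncate L f - f) x, W x⟫_ℝ| ≤ T * M := by
  have hM0 : 0 ≤ M := by
    have h := hM 0
    simpa [Torus.freqNormSq] using h
  have hsm : Torus.IsSmooth (Torus.fourierTruncate L f - f) := (Torus.isSmooth_fourierTruncate L f).sub hf
  have hP := Torus.integral_inner_eq_sum_freqBall (hsm.memLp 2) (hW.memLp 2) hband
  rw [hP]
  -- each term: zero on the ball of radius `L`, bounded by `‖f̂ κ‖ · M` outside
  have hcoef : ∀ κ, mFourierCoeff (EuclideanSpace.complexify ∘ (Torus.fourierTruncate L f - f)) κ =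
      if κ ∈ Torus.freqBall L then 0 else -mFourierCoeff (EuclideanSpace.complexify ∘ f) κ :=
    fun κ => Torus.mFourierCoeff_fourierTruncate_sub hf.integrable L κ
  set S : Finset (Fin 3 → ℤ) := (Torus.freqBall N).filter (fun κ => κ ∉ Torus.freqBall L) with hSdef
  have hS : ∀ κ ∈ S, κ ∉ Torus.freqBall L := fun κ hκ => (Finset.mem_filter.1 hκ).2
  have hterm : ∀ κ ∈ Torus.freqBall N,
      |(⟪mFourierCoeff (EuclideanSpace.complexify ∘ (Torus.fourierTruncate L f - f)) κ,
          mFourierCoeff (EuclideanSpace.complexify ∘ W) κ⟫_ℂ).re| ≤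
        (if κ ∈ Torus.freqBall L then 0 else ‖mFourierCoeff (EuclideanSpace.complexify ∘ f) κ‖) * M := by
    intro κ _
    rw [hcoef κ]
    split_ifs with hκ
    · simp
    · rw [inner_neg_left, Complex.neg_re, abs_neg]
      have hκ0 : κ ≠ 0 := by
        rintro rfl
        exact hκ (Torus.zero_mem_freqBall L)
      have h1 : (1 : ℝ) ≤ Real.sqrt (Torus.freqNormSq κ) := by
        rw [show (1 : ℝ) = Real.sqrt 1 by simp]
        exact Real.sqrt_le_sqrt (Torus.one_le_freqNormSq_of_ne_zero hκ0)
      have hWκ : ‖mFourierCoeff (EuclideanSpace.complexify ∘ W) κ‖ ≤ M := by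
        have h := hM κ
        have hn := norm_nonneg (mFourierCoeff (EuclideanSpace.complexify ∘ W) κ)
        nlinarith [h, hn, h1]
      calc |(⟪mFourierCoeff (EuclideanSpace.complexify ∘ f) κ, mFourierCoeff (EuclideanSpace.complexify ∘ W) κ⟫_ℂ).re|
          ≤ ‖mFourierCoeff (EuclideanSpace.complexify ∘ f) κ‖ * ‖mFourierCoeff (EuclideanSpace.complexify ∘ W) κ‖ :=
            abs_re_inner_le_norm_mul _ _
        _ ≤ ‖mFourierCoeff (EuclideanSpace.complexify ∘ f) κ‖ * M :=
            mul_le_mul_of_nonneg_left hWκ (norm_nonneg _)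
  calc |∑ κ ∈ Torus.freqBall N, (⟪mFourierCoeff (EuclideanSpace.complexify ∘ (Torus.fourierTruncate L f - f)) κ,
          mFourierCoeff (EuclideanSpace.complexify ∘ W) κ⟫_ℂ).re|
      ≤ ∑ κ ∈ Torus.freqBall N, |(⟪mFourierCoeff (EuclideanSpace.complexify ∘ (Torus.fourierTruncate L f - f)) κ,
          mFourierCoeff (EuclideanSpace.complexify ∘ W) κ⟫_ℂ).re| := Finset.abs_sum_le_sum_abs _ _
    _ ≤ ∑ κ ∈ Torus.freqBall N,
          (if κ ∈ Torus.freqBall L then 0 else ‖mFourierCoeff (EuclideanSpace.complexify ∘ f) κ‖) * M :=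
        Finset.sum_le_sum hterm
    _ = (∑ κ ∈ S, ‖mFourierCoeff (EuclideanSpace.complexify ∘ f) κ‖) * M := by
        rw [Finset.sum_mul, hSdef, Finset.sum_filter]
        refine Finset.sum_congr rfl fun κ _ => ?_
        split_ifs <;> simp
    _ ≤ T * M := mul_le_mul_of_nonneg_right (hT S hS) hM0

/-! ### Part A: the dressed state is CHEAP under five numeric inequalities -/

set_option maxHeartbeats 400000 in
/-- **CHEAP at `η` from a far field with a linear response — numeric form.** See the module docstring. The
hypotheses on `U`, `b` are exactly the clauses of the lead's `Response.ResponseStatement` with the response constants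
abstracted into reals (`eU, gU, sU, wU` for the shear; `Eb, Gb, Sb` for the response; `δlin, δsa` for the two
defects), plus the tail bound `T` and the energy `F2` of the force. -/
theorem cheapAt_of_farField {f U b : 𝕋 → E³} (hf : Torus.IsSmooth f)
    (hU : Torus.IsSmooth U) (hUd : Torus.IsDivFree U) (hUz : Torus.HasZeroMean U) (hUU : ∀ x, Torus.convect U U x = 0)
    (hb : Torus.IsSmooth b) (hbd : Torus.IsDivFree b) (hbz : Torus.HasZeroMean b)
    {L : ℕ} {eU gU sU wU Eb Gb Sb δlin δsa T F2 s t η : ℝ}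
    (hUe : (∫ x, ‖U x‖ ^ 2) ≤ eU) (hUg : (Torus.eGradNormSq U).toReal ≤ gU)
    (hUs : ∀ N : ℕ, ∑ κ ∈ Torus.freqBall N, Real.sqrt (Torus.freqNormSq κ) *
      ‖mFourierCoeff (EuclideanSpace.complexify ∘ U) κ‖ ≤ sU)
    (hUw : |∫ x, ⟪U x, f x⟫_ℝ| ≤ wU)
    (hbe : (∫ x, ‖b x‖ ^ 2) ≤ Eb) (hbg : (Torus.eGradNormSq b).toReal ≤ Gb)
    (hbs : ∀ N : ℕ, ∑ κ ∈ Torus.freqBall N, Real.sqrt (Torus.freqNormSq κ) *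
      ‖mFourierCoeff (EuclideanSpace.complexify ∘ b) κ‖ ≤ Sb)
    (hdef : ∀ (N : ℕ) (W : 𝕋 → E³) (M : ℝ), Torus.IsSmooth W → Torus.IsDivFree W → Torus.HasZeroMean W →
      (∀ κ, (N : ℝ) ^ 2 < Torus.freqNormSq κ → mFourierCoeff (EuclideanSpace.complexify ∘ W) κ = 0) →
      (∀ κ, Real.sqrt (Torus.freqNormSq κ) * ‖mFourierCoeff (EuclideanSpace.complexify ∘ W) κ‖ ≤ M) →
      |∫ x, ⟪Torus.convect U b x + Torus.convect b U x - Torus.fourierTruncate L f x, W x⟫_ℝ| ≤ δlin * M ∧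
      |∫ x, ⟪Torus.convect b b x, W x⟫_ℝ| ≤ δsa * M)
    (hF2 : (∫ x, ‖f x‖ ^ 2) ≤ F2)
    (hT : ∀ S : Finset (Fin 3 → ℤ), (∀ κ ∈ S, κ ∉ Torus.freqBall L) →
      ∑ κ ∈ S, ‖mFourierCoeff (EuclideanSpace.complexify ∘ f) κ‖ ≤ T)
    (hs : 0 < s) (hst : s * t = 1)
    (n1 : 2 * s ^ 2 * gU + 2 * t ^ 2 * Gb ≤ η ^ (-(11 / 10 : ℝ)))
    (n2 : 2 * s ^ 2 * eU + 2 * t ^ 2 * Eb ≤ η ^ (-(11 / 10 : ℝ)))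
    (n3 : s * sU + t * Sb ≤ η ^ (-(3 / 5 : ℝ)))
    (n4 : s * wU + t * ((Eb + F2) / 2) ≤ η ^ (2 / 5 : ℝ))
    (n5 : δlin + t ^ 2 * δsa + T ≤ η) :
    Torus.IsSmooth (s • U + t • b) ∧ Torus.IsDivFree (s • U + t • b) ∧ Torus.HasZeroMean (s • U + t • b) ∧
      (Torus.eGradNormSq (s • U + t • b)).toReal ≤ η ^ (-(11 / 10 : ℝ)) ∧
      (∫ x, ‖(s • U + t • b) x‖ ^ 2) ≤ η ^ (-(11 / 10 : ℝ)) ∧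
      (∀ N : ℕ, ∑ κ ∈ Torus.freqBall N, Real.sqrt (Torus.freqNormSq κ) *
        ‖mFourierCoeff (EuclideanSpace.complexify ∘ (s • U + t • b)) κ‖ ≤ η ^ (-(3 / 5 : ℝ))) ∧
      |∫ x, ⟪(s • U + t • b) x, f x⟫_ℝ| ≤ η ^ (2 / 5 : ℝ) ∧
      ∀ (N : ℕ) (W : 𝕋 → E³) (M : ℝ), Torus.IsSmooth W → Torus.IsDivFree W → Torus.HasZeroMean W →
        (∀ κ, (N : ℝ) ^ 2 < Torus.freqNormSq κ → mFourierCoeff (EuclideanSpace.complexify ∘ W) κ = 0) →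
        (∀ κ, Real.sqrt (Torus.freqNormSq κ) * ‖mFourierCoeff (EuclideanSpace.complexify ∘ W) κ‖ ≤ M) →
        |∫ x, ⟪Torus.convect (s • U + t • b) (s • U + t • b) x - f x, W x⟫_ℝ| ≤ η * M := by
  have ht : 0 < t := pos_of_mul_pos_right (by rw [hst]; exact one_pos) hs.le
  obtain ⟨ha, had, haz⟩ := farField_regular hU hUd hUz hb hbd hbz s t
  refine ⟨ha, had, haz, ?_, ?_, ?_, ?_, ?_⟩
  · -- enstrophy
    have h := toReal_eGradNormSq_farField_le hU hb s t
    have h1 : 2 * s ^ 2 * (Torus.eGradNormSq U).toReal ≤ 2 * s ^ 2 * gU :=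
      mul_le_mul_of_nonneg_left hUg (by positivity)
    have h2 : 2 * t ^ 2 * (Torus.eGradNormSq b).toReal ≤ 2 * t ^ 2 * Gb :=
      mul_le_mul_of_nonneg_left hbg (by positivity)
    linarith
  · -- energy
    have h := integral_norm_sq_farField_le hU hb s t
    have h1 : 2 * s ^ 2 * (∫ x, ‖U x‖ ^ 2) ≤ 2 * s ^ 2 * eU := mul_le_mul_of_nonneg_left hUe (by positivity)
    have h2 : 2 * t ^ 2 * (∫ x, ‖b x‖ ^ 2) ≤ 2 * t ^ 2 * Eb := mul_le_mul_of_nonneg_left hbe (by positivity)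
    linarith
  · -- slope
    intro N
    have h := slope_farField_le hU hb s t N
    rw [abs_of_pos hs, abs_of_pos ht] at h
    have h1 := mul_le_mul_of_nonneg_left (hUs N) hs.le
    have h2 := mul_le_mul_of_nonneg_left (hbs N) ht.le
    linarith
  · -- work (Young for the response, the shear's work as given)
    rw [work_farField_eq hU hb hf s t]
    have hbf := abs_integral_inner_le_half_add hb hf
    have h1 : |s * ∫ x, ⟪U x, f x⟫_ℝ| ≤ s * wU := by
      rw [abs_mul, abs_of_pos hs]; exact mul_le_mul_of_nonneg_left hUw hs.le
    have h2 : |t * ∫ x, ⟪b x, f x⟫_ℝ| ≤ t * ((Eb + F2) / 2) := by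
      rw [abs_mul, abs_of_pos ht]
      refine mul_le_mul_of_nonneg_left (hbf.trans ?_) ht.le
      linarith
    calc |s * (∫ x, ⟪U x, f x⟫_ℝ) + t * ∫ x, ⟪b x, f x⟫_ℝ|
        ≤ |s * ∫ x, ⟪U x, f x⟫_ℝ| + |t * ∫ x, ⟪b x, f x⟫_ℝ| := abs_add_le _ _
      _ ≤ s * wU + t * ((Eb + F2) / 2) := add_le_add h1 h2
      _ ≤ η ^ (2 / 5 : ℝ) := n4
  · -- defect
    intro N W M hW hWd hWz hWband hWM
    have hM0 : 0 ≤ M := by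
      have h := hWM 0
      simpa [Torus.freqNormSq] using h
    obtain ⟨hlin, hsa⟩ := hdef N W M hW hWd hWz hWband hWM
    have htail := abs_integral_inner_truncate_sub_le hf hW hWband hWM hT
    rw [farField_defect hU hb hf hW hUU hst]
    -- split `f = P_L f + (f − P_L f)` inside the linearised defect
    have hsplit : (∫ x, ⟪Torus.convect U b x + Torus.convect b U x - f x, W x⟫_ℝ) =
        (∫ x, ⟪Torus.convect U b x + Torus.convect b U x - Torus.fourierTruncate L f x, W x⟫_ℝ) +
          ∫ x, ⟪(Torus.fourierTruncate L f - f) x, W x⟫_ℝ := by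
      have i1 : Integrable (fun x => ⟪Torus.convect U b x + Torus.convect b U x - Torus.fourierTruncate L f x, W x⟫_ℝ)
          volume := ((((hU.convect hb).add (hb.convect hU)).sub (Torus.isSmooth_fourierTruncate L f)).inner hW).integrable
      have i2 : Integrable (fun x => ⟪(Torus.fourierTruncate L f - f) x, W x⟫_ℝ) volume :=
        (((Torus.isSmooth_fourierTruncate L f).sub hf).inner hW).integrable
      rw [← integral_add i1 i2]
      refine integral_congr_ae (ae_of_all _ fun x => ?_)
      simp only [Pi.sub_apply, inner_add_left, inner_sub_left]
      ring
    rw [hsplit]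
    have e3 : |t ^ 2 * ∫ x, ⟪Torus.convect b b x, W x⟫_ℝ| ≤ t ^ 2 * (δsa * M) := by
      rw [abs_mul, abs_of_pos (by positivity : 0 < t ^ 2)]
      exact mul_le_mul_of_nonneg_left hsa (by positivity)
    calc |(∫ x, ⟪Torus.convect U b x + Torus.convect b U x - Torus.fourierTruncate L f x, W x⟫_ℝ) +
            (∫ x, ⟪(Torus.fourierTruncate L f - f) x, W x⟫_ℝ) + t ^ 2 * ∫ x, ⟪Torus.convect b b x, W x⟫_ℝ|
        ≤ |∫ x, ⟪Torus.convect U b x + Torus.convect b U x - Torus.fourierTruncate L f x, W x⟫_ℝ| +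
            |∫ x, ⟪(Torus.fourierTruncate L f - f) x, W x⟫_ℝ| + |t ^ 2 * ∫ x, ⟪Torus.convect b b x, W x⟫_ℝ| := by
          exact (abs_add_le _ _).trans (by gcongr; exact abs_add_le _ _)
      _ ≤ δlin * M + T * M + t ^ 2 * (δsa * M) := add_le_add (add_le_add hlin htail) e3
      _ = (δlin + t ^ 2 * δsa + T) * M := by ring
      _ ≤ η * M := mul_le_mul_of_nonneg_right n5 hM0

end Summit.AnomalousDissipation.AnomalousDissipation.Theorems.KolmogorovFloor.Negative
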